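import Summits.ValiantsHypothesis.ValiantsHypothesis.Theorems.BarrierLeverChowHitsThinRowPartitionMinorsRLabels

/-!
# Route BarrierLever — item `ChowHitsThinRowPartitionMinorsR` (stmt-ValiantsHypothesis-21850, budget
# `h·h`): the labelled certificate with public forms only on the USED coordinates

Helper file (`--supports stmt-ValiantsHypothesis-21850`; cell valiant-natproofs, rung V4, 𝒟-side;
seat val-np-p5 gen 28).  Closes NO item; definition-free; imports this seat's `…RLabels`.

`chowHitsHH_of_labels_used` is `chowHitsHH_of_labels` with the sharper budget
`|{U i : |u i| = 1} ∪ {{c} : c ∈ ⋃_j w j}| + 2 · #{i : |u i| = 2} ≤ h·h`: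
the public singleton forms `1 + y_c` are needed only for the coordinates `c` that occur in some
column (scale choice `exists_good_scale_sq_used`); the rest of the witness and of the proof
(`M̂ = P · B̃_s`, `P` triangular in `⊆`) is unchanged.  This is the form used by
`…ChowHitsThinRowPartitionMinorsRDownClosed` (down-closed column families: every thin layout is hit).

WHAT THIS IS NOT: item 21850 is NOT proved; nothing on items 21882 / 19717, on crux
stmt-ValiantsHypothesis-14610, or on `VP` versus `VNP`.
-/

set_option linter.dupNamespace false

namespace Summit.ValiantsHypothesis.ValiantsHypothesis.Theorems.BarrierLever.ChowThinHH

open Finset MvPolynomial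
open Summit.ValiantsHypothesis.ValiantsHypothesis.Theorems.BarrierLever.ChowFactor
  (coeff_partitionExpo_mul_yOnly totalDegree_affine_le)
open Summit.ValiantsHypothesis.ValiantsHypothesis.Theorems.BarrierLever.ChowThinAll
  (coeff_single_prod_label coeff_mul_tinv_mul_form0G coeff_tinvG yOnly_tinvG yOnly_form0G
    coeff_tprod_eq_zero coeff_empty_prod_eqG)
open Summit.ValiantsHypothesis.ValiantsHypothesis.Theorems.BarrierLever.CorankRepair (partitionExpo_eq_iff)

variable {h r : ℕ}

/-- **Labelled certificate at budget `h·h`, public forms on the used coordinates only.**  (`u`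
injective of size `≤ 2`; `U` injective, down-closed, `det [U i ⊆ w j] ≠ 0`, the empty row labelled `∅`;
budget `|{U i : |u i| = 1} ∪ {{c} : c ∈ ⋃_j w j}| + 2·#{i : |u i| = 2} ≤ h·h`.) -/
theorem chowHitsHH_of_labels_used (h r : ℕ) (u w : Fin r → Finset (Fin h))
    (hu : Function.Injective u) (hu2 : ∀ i, (u i).card ≤ 2)
    (U : Fin r → Finset (Fin h)) (hUinj : Function.Injective U)
    (hUdown : ∀ i (S : Finset (Fin h)), S ⊆ U i → ∃ i', U i' = S)
    (hUempty : ∀ i, u i = ∅ → U i = ∅)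
    (hZ : (Matrix.of fun i j : Fin r => if U i ⊆ w j then (1 : ℂ) else 0).det ≠ 0)
    (hbudget : ((Finset.univ.filter fun i : Fin r => (u i).card = 1).image U ∪
        (Finset.univ.biUnion w).image fun c : Fin h => ({c} : Finset (Fin h))).card +
      2 * (Finset.univ.filter fun i : Fin r => (u i).card = 2).card ≤ h * h) :
    ∃ ℓ : Fin (h * h) → MvPolynomial (Fin (h + h)) ℂ, (∀ k, (ℓ k).totalDegree ≤ 1) ∧
      (Matrix.of fun i j : Fin r => MvPolynomial.coeff
        (∑ a ∈ u i, Finsupp.single (Fin.castAdd h a) 1 +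
          ∑ c ∈ w j, Finsupp.single (Fin.natAdd h c) 1) (∏ k, ℓ k)).det ≠ 0 := by
  classical
  -- Step 0: the index sets
  set Sing : Finset (Fin r) := Finset.univ.filter fun i : Fin r => (u i).card = 1 with hSing
  set T : Finset (Fin r) := Finset.univ.filter fun i : Fin r => (u i).card = 2 with hT
  have hmemT : ∀ i, i ∈ T ↔ (u i).card = 2 := fun i => by simp [hT]
  have hT2 : ∀ i ∈ T, (u i).card = 2 := fun i hi => (hmemT i).mp hi
  set PT : Finset (Finset (Fin h)) := Sing.image U ∪
    (Finset.univ.biUnion w).image fun c : Fin h => ({c} : Finset (Fin h)) with hPT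
  have hsing : ∀ j, ∀ c ∈ w j, ({c} : Finset (Fin h)) ∈ PT := fun j c hc =>
    Finset.mem_union_right _ (Finset.mem_image.mpr
      ⟨c, Finset.mem_biUnion.mpr ⟨j, Finset.mem_univ _, hc⟩, rfl⟩)
  have hUPT : ∀ i, (u i).card = 1 → U i ∈ PT := fun i hi =>
    Finset.mem_union_left _ (Finset.mem_image.mpr ⟨i, by simp [hSing, hi], rfl⟩)
  -- Step 1: the scale
  obtain ⟨s, hs, hBt⟩ := exists_good_scale_sq_used U w PT hsing T U hZ
  set γ : Finset (Fin h) → Fin h → ℂ :=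
    fun V c => (if V.card ≤ 1 then (1 : ℂ) else s) * (if c ∈ V then 1 else 0) with hγ
  have hγsupp : ∀ (V : Finset (Fin h)) (c : Fin h), c ∉ V → γ V c = 0 := by
    intro V c hc
    simp only [hγ, if_neg hc, mul_zero]
  have hγprod : ∀ V : Finset (Fin h), ∏ c ∈ V, γ V c ≠ 0 := by
    intro V
    refine Finset.prod_ne_zero_iff.mpr fun c hc => ?_
    simp only [hγ, if_pos hc, mul_one]
    split_ifs
    · exact one_ne_zero
    · exact hs
  set γ₂ : Finset (Fin h) → Fin h → ℂ := fun V c => s * (if c ∈ V then (1 : ℂ) else 0) with hγ₂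
  have hγ₂supp : ∀ (V : Finset (Fin h)) (c : Fin h), c ∉ V → γ₂ V c = 0 := by
    intro V c hc
    simp only [hγ₂, if_neg hc, mul_zero]
  -- Step 2: the label map on the `x`-variables and the forms
  set L : Fin h → Finset (Fin h) := fun a =>
    if hx : ∃ i, u i = {a} then U (Classical.choose hx) else ∅ with hL
  have hLeq : ∀ i a, u i = {a} → L a = U i := by
    intro i a hia
    have hx : ∃ i, u i = {a} := ⟨i, hia⟩
    have e : L a = U (Classical.choose hx) := by simp only [hL, dif_pos hx]
    rw [e, hu ((Classical.choose_spec hx).trans hia.symm)]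
  set κ : Fin h → Finset (Fin h) → ℂ := fun a V => if V = L a then (1 : ℂ) else 0 with hκ
  set F : MvPolynomial (Fin (h + h)) ℂ := ∏ V ∈ PT,
    (C 1 + ∑ a, C (κ a V) * X (Fin.castAdd h a) + ∑ c, C (γ V c) * X (Fin.natAdd h c)) with hF
  set F0 : MvPolynomial (Fin (h + h)) ℂ := ∏ V ∈ PT,
    (C 1 + ∑ a, C ((fun (_ : Fin h) (_ : Finset (Fin h)) => (0 : ℂ)) a V) * X (Fin.castAdd h a) +
      ∑ c, C (γ V c) * X (Fin.natAdd h c)) with hF0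
  set Yf : Fin r → MvPolynomial (Fin (h + h)) ℂ := fun i =>
    C 1 + ∑ a, C ((fun (_ : Fin h) (_ : Finset (Fin h)) => (0 : ℂ)) a (U i)) * X (Fin.castAdd h a) +
      ∑ c, C (γ₂ (U i) c) * X (Fin.natAdd h c) with hYf
  have hYeq : ∀ i, Yf i = C 1 + ∑ c, C (γ₂ (U i) c) * X (Fin.natAdd h c) :=
    fun i => form0_eq (γ₂ (U i)) (U i)
  have hYeq' : ∀ i, (C 1 + ∑ c, C (s * (if c ∈ U i then (1 : ℂ) else 0)) * X (Fin.natAdd h c) :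
      MvPolynomial (Fin (h + h)) ℂ) = Yf i := fun i => (hYeq i).symm
  -- Step 3: packaging of `F` as a `Fin m`-indexed product
  set m : ℕ := PT.card with hm
  set e : PT ≃ Fin m := PT.equivFin with he
  set φ : Fin m → MvPolynomial (Fin (h + h)) ℂ := fun k =>
    C 1 + ∑ a, C (κ a (e.symm k : Finset (Fin h))) * X (Fin.castAdd h a) +
      ∑ c, C (γ (e.symm k : Finset (Fin h)) c) * X (Fin.natAdd h c) with hφ
  have hφprod : ∏ k, φ k = F := by
    rw [hF, ← Finset.prod_coe_sort PT]
    exact Fintype.prod_equiv e.symm _ _ fun k => rfl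
  have hφdeg : ∀ k, (φ k).totalDegree ≤ 1 := by
    intro k
    have e1 : φ k = C 1 + ∑ v : Fin (h + h),
        C (Fin.append (fun a => κ a (e.symm k : Finset (Fin h))) (fun c => γ (e.symm k : Finset (Fin h)) c) v) *
          X v := by
      rw [hφ, Fin.sum_univ_add]
      simp only [Fin.append_left, Fin.append_right, add_assoc]
    rw [e1]
    exact totalDegree_affine_le _ _
  have hbudget' : m + 2 * T.card ≤ h * h := hbudget
  refine chowHitsHH_of_gadgetCertificate u w hu hu2 T hT2 m φ hφdeg (fun i c => γ₂ (U i) c) hbudget' ?_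
  simp_rw [hφprod, hγ₂, hYeq']
  -- Step 4: the reduced matrix `M̂` and the coefficients `b`
  set Q : MvPolynomial (Fin (h + h)) ℂ := ∏ i' ∈ T, Yf i' ^ 2 with hQ
  have hQy : ∀ s' ∈ Q.support, ∀ a : Fin h, s' (Fin.castAdd h a) = 0 :=
    ChowSubcube.yOnly_prod T _ fun i' _ => by
      rw [pow_two]; exact ChowSubcube.yOnly_mul (yOnly_form0G γ₂ (U i')) (yOnly_form0G γ₂ (U i'))
  obtain ⟨b, hb⟩ : ∃ b : Finset (Fin h) → ℂ, ∀ W', b W' = coeff (∑ a ∈ (∅ : Finset (Fin h)),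
      Finsupp.single (Fin.castAdd h a) 1 + ∑ c ∈ W', Finsupp.single (Fin.natAdd h c) 1) (F0 * Q) :=
    ⟨fun W' => _, fun _ => rfl⟩
  have hbF : ∀ W', coeff (∑ a ∈ (∅ : Finset (Fin h)), Finsupp.single (Fin.castAdd h a) 1 +
      ∑ c ∈ W', Finsupp.single (Fin.natAdd h c) 1) (F * Q) = b W' := by
    intro W'
    rw [hb, coeff_partitionExpo_mul_yOnly F Q hQy ∅ W', coeff_partitionExpo_mul_yOnly F0 Q hQy ∅ W']
    refine Finset.sum_congr rfl fun d _ => ?_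
    rw [hF, hF0, coeff_empty_prod_eqG κ (fun _ _ => (0 : ℂ)) γ PT (W' \ d)]
  -- truncated inverses and row polynomials
  set t : Finset (Fin h) → MvPolynomial (Fin (h + h)) ℂ := fun V =>
    ∑ U' ∈ V.powerset, monomial (∑ a ∈ (∅ : Finset (Fin h)), Finsupp.single (Fin.castAdd h a) 1 +
      ∑ c ∈ U', Finsupp.single (Fin.natAdd h c) 1)
      ((-1 : ℂ) ^ U'.card * (U'.card.factorial : ℂ) * ∏ c ∈ U', γ V c) with ht
  set t₂ : Finset (Fin h) → MvPolynomial (Fin (h + h)) ℂ := fun V =>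
    ∑ U' ∈ V.powerset, monomial (∑ a ∈ (∅ : Finset (Fin h)), Finsupp.single (Fin.castAdd h a) 1 +
      ∑ c ∈ U', Finsupp.single (Fin.natAdd h c) 1)
      ((-1 : ℂ) ^ U'.card * (U'.card.factorial : ℂ) * ∏ c ∈ U', γ₂ V c) with ht₂
  set ρp : Fin r → MvPolynomial (Fin (h + h)) ℂ := fun i =>
    if (u i).card = 2 then t₂ (U i) * t₂ (U i) else if (u i).card = 1 then t (U i) else 1 with hρp
  obtain ⟨ρ, hρ⟩ : ∃ ρ : Fin r → Finset (Fin h) → ℂ, ∀ i X', ρ i X' = coeff (∑ a ∈ (∅ : Finset (Fin h)),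
      Finsupp.single (Fin.castAdd h a) 1 + ∑ c ∈ X', Finsupp.single (Fin.natAdd h c) 1) (ρp i) :=
    ⟨fun i X' => _, fun _ _ => rfl⟩
  have hcoeff1 : ∀ X' : Finset (Fin h), coeff (∑ a ∈ (∅ : Finset (Fin h)),
      Finsupp.single (Fin.castAdd h a) 1 + ∑ c ∈ X', Finsupp.single (Fin.natAdd h c) 1)
      (1 : MvPolynomial (Fin (h + h)) ℂ) = if X' = ∅ then 1 else 0 := by
    intro X'
    rw [coeff_one]
    by_cases h0 : X' = ∅
    · subst h0; simp
    · rw [if_neg h0, if_neg]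
      intro e'
      exact h0 ((partitionExpo_eq_iff ∅ ∅ ∅ X').mp (by simpa using e')).2.symm
  -- Step 5: every entry of `M̂` is `Σ_{X ⊆ w j} b (w j \ X) · ρ i X`
  have hentry : ∀ i j, (if i ∈ T then coeff (∑ a ∈ (∅ : Finset (Fin h)), Finsupp.single (Fin.castAdd h a) 1 +
        ∑ c ∈ w j, Finsupp.single (Fin.natAdd h c) 1) (F * ∏ i' ∈ T.erase i, Yf i' ^ 2)
      else coeff (∑ a ∈ u i, Finsupp.single (Fin.castAdd h a) 1 +
        ∑ c ∈ w j, Finsupp.single (Fin.natAdd h c) 1) (F * ∏ i' ∈ T, Yf i' ^ 2)) =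
      ∑ X' ∈ (w j).powerset, b (w j \ X') * ρ i X' := by
    intro i j
    by_cases hiT : i ∈ T
    · -- gadget row
      rw [if_pos hiT]
      have hi2 : (u i).card = 2 := hT2 i hiT
      have e1 : (F * ∏ i' ∈ T.erase i, Yf i' ^ 2) * (t₂ (U i) * Yf i) * (t₂ (U i) * Yf i) =
          (F * Q) * (t₂ (U i) * t₂ (U i)) := by
        rw [hQ, ← Finset.prod_erase_mul T (fun i' => Yf i' ^ 2) hiT]
        ring
      rw [← coeff_mul_tinv_mul_form0G γ₂ (U i) (hγ₂supp (U i)) _ (w j),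
        ← coeff_mul_tinv_mul_form0G γ₂ (U i) (hγ₂supp (U i)) _ (w j)]
      change coeff _ ((F * ∏ i' ∈ T.erase i, Yf i' ^ 2) * (t₂ (U i) * Yf i) * (t₂ (U i) * Yf i)) = _
      rw [e1, coeff_partitionExpo_mul_yOnly _ _
        (ChowSubcube.yOnly_mul (yOnly_tinvG γ₂ (U i)) (yOnly_tinvG γ₂ (U i))) ∅ (w j)]
      refine Finset.sum_congr rfl fun X' _ => ?_
      rw [hbF, hρ, hρp]
      simp only [if_pos hi2, ht₂]
    · rw [if_neg hiT]
      have hn2 : (u i).card ≠ 2 := fun e' => hiT ((hmemT i).mpr e')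
      have hui2 := hu2 i
      rcases Nat.lt_or_ge (u i).card 1 with h0 | h1
      · -- empty row
        have hui : u i = ∅ := Finset.card_eq_zero.mp (by omega)
        have hterm : ∀ X' ∈ (w j).powerset, b (w j \ X') * ρ i X' = if X' = ∅ then b (w j \ X') else 0 := by
          intro X' _
          rw [hρ, hρp]
          simp only [if_neg hn2, show ¬ (u i).card = 1 by omega, if_false, hcoeff1]
          split_ifs <;> simp
        rw [Finset.sum_congr rfl hterm, Finset.sum_ite_eq', if_pos (Finset.empty_mem_powerset _),
          Finset.sdiff_empty, hui, ← hQ, hbF]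
      · -- singleton row
        have hc1 : (u i).card = 1 := by omega
        obtain ⟨a, ha⟩ := Finset.card_eq_one.mp hc1
        have hLa : L a = U i := hLeq i a ha
        have hLaPT : L a ∈ PT := by rw [hLa]; exact hUPT i hc1
        rw [← hQ, coeff_partitionExpo_mul_yOnly F Q hQy (u i) (w j)]
        have e2 : ∀ d ∈ (w j).powerset, coeff (∑ a' ∈ u i, Finsupp.single (Fin.castAdd h a') 1 +
            ∑ c ∈ w j \ d, Finsupp.single (Fin.natAdd h c) 1) F *
            coeff (∑ a' ∈ (∅ : Finset (Fin h)), Finsupp.single (Fin.castAdd h a') 1 +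
              ∑ c ∈ d, Finsupp.single (Fin.natAdd h c) 1) Q =
            coeff (∑ a' ∈ (∅ : Finset (Fin h)), Finsupp.single (Fin.castAdd h a') 1 +
              ∑ c ∈ w j \ d, Finsupp.single (Fin.natAdd h c) 1) (∏ V ∈ PT.erase (L a),
                (C 1 + ∑ a', C ((fun (_ : Fin h) (_ : Finset (Fin h)) => (0 : ℂ)) a' V) * X (Fin.castAdd h a') +
                  ∑ c, C (γ V c) * X (Fin.natAdd h c))) *
            coeff (∑ a' ∈ (∅ : Finset (Fin h)), Finsupp.single (Fin.castAdd h a') 1 +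
              ∑ c ∈ d, Finsupp.single (Fin.natAdd h c) 1) Q := by
          intro d _
          rw [ha, hF, coeff_single_prod_label L γ PT a hLaPT (w j \ d)]
        rw [Finset.sum_congr rfl e2, ← coeff_partitionExpo_mul_yOnly _ Q hQy ∅ (w j)]
        set Fm := ∏ V ∈ PT.erase (L a),
          (C 1 + ∑ a', C ((fun (_ : Fin h) (_ : Finset (Fin h)) => (0 : ℂ)) a' V) * X (Fin.castAdd h a') +
            ∑ c, C (γ V c) * X (Fin.natAdd h c)) with hFm
        have e3 : (Fm * Q) * (t (L a) * (C 1 + ∑ a', C ((fun (_ : Fin h) (_ : Finset (Fin h)) => (0 : ℂ)) a' (L a)) *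
            X (Fin.castAdd h a') + ∑ c, C (γ (L a) c) * X (Fin.natAdd h c))) = (F0 * Q) * t (L a) := by
          rw [hF0, ← Finset.prod_erase_mul PT _ hLaPT]
          ring
        rw [← coeff_mul_tinv_mul_form0G γ (L a) (hγsupp (L a)) (Fm * Q) (w j)]
        change coeff _ ((Fm * Q) * (t (L a) * _)) = _
        rw [e3, coeff_partitionExpo_mul_yOnly _ _ (yOnly_tinvG γ (L a)) ∅ (w j)]
        refine Finset.sum_congr rfl fun X' _ => ?_
        rw [← hb, hρ, hρp]
        simp only [if_neg hn2, if_pos hc1, hLa, ht]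
  -- Step 6: support and top coefficient of the row polynomials
  have hsupp : ∀ i (X' : Finset (Fin h)), ρ i X' ≠ 0 → X' ⊆ U i := by
    intro i X' hX
    rw [hρ, hρp] at hX
    by_cases hi2 : (u i).card = 2
    · simp only [if_pos hi2] at hX
      by_contra hsub
      exact hX (coeff_tprod_eq_zero γ₂ (U i) (U i) X' (by rwa [Finset.union_idempotent]))
    · by_cases hi1 : (u i).card = 1
      · simp only [if_neg hi2, if_pos hi1] at hX
        by_contra hsub
        apply hX
        rw [ht, coeff_tinvG, if_neg hsub]
      · simp only [if_neg hi2, if_neg hi1, hcoeff1] at hX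
        by_cases hx0 : X' = ∅
        · rw [hx0]; exact Finset.empty_subset _
        · exact absurd (if_neg hx0) hX
  have htop : ∀ i, ρ i (U i) ≠ 0 := by
    intro i
    rw [hρ, hρp]
    by_cases hi2 : (u i).card = 2
    · simp only [if_pos hi2]
      exact coeff_tsq_top s hs (U i)
    · by_cases hi1 : (u i).card = 1
      · simp only [if_neg hi2, if_pos hi1]
        rw [ht, coeff_tinvG, if_pos (subset_refl _)]
        exact mul_ne_zero (mul_ne_zero (pow_ne_zero _ (by norm_num))
          (by exact_mod_cast (U i).card.factorial_ne_zero)) (hγprod (U i))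
      · simp only [if_neg hi2, if_neg hi1]
        have hui : u i = ∅ := Finset.card_eq_zero.mp (by have := hu2 i; omega)
        rw [hUempty i hui, hcoeff1, if_pos rfl]
        exact one_ne_zero
  -- Step 7: the factorisation `M̂ = P · B̃`
  set P : Matrix (Fin r) (Fin r) ℂ := Matrix.of fun i i' => ρ i (U i') with hP
  set Bt : Matrix (Fin r) (Fin r) ℂ := Matrix.of fun i' j => if U i' ⊆ w j then b (w j \ U i') else 0
    with hBtdef
  have hfact : (Matrix.of fun i j : Fin r =>
      if i ∈ T then coeff (∑ a ∈ (∅ : Finset (Fin h)), Finsupp.single (Fin.castAdd h a) 1 +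
          ∑ c ∈ w j, Finsupp.single (Fin.natAdd h c) 1) (F * ∏ i' ∈ T.erase i, Yf i' ^ 2)
      else coeff (∑ a ∈ u i, Finsupp.single (Fin.castAdd h a) 1 +
          ∑ c ∈ w j, Finsupp.single (Fin.natAdd h c) 1) (F * ∏ i' ∈ T, Yf i' ^ 2)) = P * Bt := by
    ext i j
    rw [Matrix.of_apply, hentry i j, Matrix.mul_apply]
    simp only [hP, hBtdef, Matrix.of_apply, mul_ite, mul_zero]
    have e1 : ∑ i', (if U i' ⊆ w j then ρ i (U i') * b (w j \ U i') else 0) =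
        ∑ X' ∈ (Finset.univ : Finset (Fin r)).image U,
          (if X' ⊆ w j then ρ i X' * b (w j \ X') else 0) := by
      rw [Finset.sum_image (fun i₁ _ i₂ _ e' => hUinj e')]
    have e2 : ∑ X' ∈ (Finset.univ : Finset (Fin r)).image U,
          (if X' ⊆ w j then ρ i X' * b (w j \ X') else 0) =
        ∑ X' ∈ ((Finset.univ : Finset (Fin r)).image U).filter (fun X' => X' ⊆ w j),
          ρ i X' * b (w j \ X') := by
      rw [Finset.sum_filter]
    have e3 : ((Finset.univ : Finset (Fin r)).image U).filter (fun X' => X' ⊆ w j) =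
        (w j).powerset.filter (fun X' => ∃ i', U i' = X') := by
      ext X'
      simp only [Finset.mem_filter, Finset.mem_image, Finset.mem_univ, true_and, Finset.mem_powerset]
      exact and_comm
    have e4 : ∑ X' ∈ (w j).powerset.filter (fun X' => ∃ i', U i' = X'), ρ i X' * b (w j \ X') =
        ∑ X' ∈ (w j).powerset, b (w j \ X') * ρ i X' := by
      rw [Finset.sum_filter_of_ne]
      · exact Finset.sum_congr rfl fun X' _ => mul_comm _ _
      · intro X' _ hne
        have hX : ρ i X' ≠ 0 := fun e' => hne (by rw [e', zero_mul])
        exact hUdown i X' (hsupp i X' hX)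
    rw [e1, e2, e3, e4]
  -- Step 8: `P` is invertible (triangular in `⊆`), `B̃` is invertible (choice of the scale)
  have hPinj : Function.Injective fun v => Matrix.vecMul v P := by
    intro c₁ c₂ hc
    rw [← sub_eq_zero]
    set c := c₁ - c₂ with hcdef
    have h0 : ∀ i', ∑ i, c i * ρ i (U i') = 0 := by
      intro i'
      have e' := congr_fun hc i'
      simp only [Matrix.vecMul, dotProduct, hP, Matrix.of_apply] at e'
      simp only [hcdef, Pi.sub_apply, sub_mul, Finset.sum_sub_distrib]
      exact sub_eq_zero.mpr e'
    have hind : ∀ n : ℕ, ∀ i, h - (U i).card = n → c i = 0 := by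
      intro n
      induction n using Nat.strong_induction_on with
      | _ n ih =>
        intro i hn
        have hsum := h0 i
        rw [← Finset.add_sum_erase _ _ (Finset.mem_univ i)] at hsum
        have hrest : ∑ i₂ ∈ (Finset.univ : Finset (Fin r)).erase i, c i₂ * ρ i₂ (U i) = 0 := by
          refine Finset.sum_eq_zero fun i₂ hi₂ => ?_
          have hne : i₂ ≠ i := (Finset.mem_erase.mp hi₂).1
          by_cases hz : ρ i₂ (U i) = 0
          · rw [hz, mul_zero]
          · have hsub : U i ⊆ U i₂ := hsupp i₂ _ hz
            have hne' : U i ≠ U i₂ := fun e' => hne (hUinj e').symm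
            have hlt : (U i).card < (U i₂).card := Finset.card_lt_card (lt_of_le_of_ne hsub hne')
            have hle : (U i₂).card ≤ h := by simpa using Finset.card_le_univ (U i₂)
            rw [ih (h - (U i₂).card) (by omega) i₂ rfl, zero_mul]
        rw [hrest, add_zero] at hsum
        exact (mul_eq_zero.mp hsum).resolve_right (htop i)
    funext i
    exact hind _ i rfl
  have hPdet : P.det ≠ 0 := by
    have hu' := Matrix.vecMul_injective_iff_isUnit.mp hPinj
    exact ((Matrix.isUnit_iff_isUnit_det _).mp hu').ne_zero
  have hBt' : Bt.det ≠ 0 := by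
    have e' : Bt = Matrix.of fun i j : Fin r => if U i ⊆ w j then
        coeff (∑ a ∈ (∅ : Finset (Fin h)), Finsupp.single (Fin.castAdd h a) 1 +
            ∑ c ∈ w j \ U i, Finsupp.single (Fin.natAdd h c) 1)
          (F0 * ∏ i' ∈ T, (C 1 + ∑ c, C (s * (if c ∈ U i' then 1 else 0)) * X (Fin.natAdd h c)) ^ 2)
        else 0 := by
      ext i j
      rw [hBtdef, Matrix.of_apply, Matrix.of_apply]
      split_ifs
      · rw [hb, hQ]
        simp_rw [hYeq']
      · rfl
    rw [e']
    exact hBt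
  rw [hfact, Matrix.det_mul]
  exact mul_ne_zero hPdet hBt'

end Summit.ValiantsHypothesis.ValiantsHypothesis.Theorems.BarrierLever.ChowThinHH
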